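import Summits.QuantumFields.YangMills.Theorems.FluctuationComparisonRegPrIntLS2BetaCoarseCurlOfLinAvg
import Summits.QuantumFields.YangMills.Theorems.FluctuationComparisonRegPrIntLS2BetaChartReadSecondOrder
import HarnessLib

/-!
# S2β · (CURL-AVG, FILE C) THE COARSE LINEARISED CURL OF THE TRUE ONE-STEP DERIVATIVE `Dψ_{U₀}(0)X` AND OF THE CHART-READ AVERAGE `ψ_{U₀}(X)` ITSELF:
# (CURL-AVG) for `Q₁^{R₀}` (FILE B2 ✓`norm_curl_covLinAvgR0_le`) `+ 4·404·ℓ·α·‖X‖` ((D1) ✓p824693) `+ 4·C_N·ℓ²·‖X‖²` ((β-3) ✓p828183; `C₂ = 4550400`)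

Cell `ym3-torus` (YM ladder rung R3 = continuum `SU(2)` Yang–Mills on the three-torus at fixed lattice data — a RUNG: NOT d = 4, NOT infinite volume, NOT a mass gap,
NOT Clay).  Width seat `ym3-torus-px13` (gen 26); crux `stmt-QuantumFields-20520`, LINE g18-1 S2β, pairing lane, AVG₂♭-ax_q ∕ `hLoc` ⟸ SUP chain ⟸ (ST) ⟸ (SCT) + lift recursion
(px17 g22 UV3-NODE §94.5); per-step brick (CURL-AVG): FILE A ✓p829604 (linearised lattice Stokes), B1 `…CoarseCurlTransports`, B2 `…CoarseCurlOfLinAvg` (the first-order statement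
for `Q₁^{R₀}(U₀)`), THIS FILE C: the same statement for the objects the sup chain actually reads — the TRUE derivative `Dψ_{U₀}(0)` of the chart-read one-step average
`ψ_{U₀}(X)(c) = Λ(Ū(Θ^B(X)·U₀)(c)·Ū(U₀)(c)⁻¹)` ((D1) ✓`norm_fderiv_chartRead_sub_covLinAvgR0_le`: `‖↑((Dψ_{U₀}(0)X)c) − Q₁^{R₀}(U₀)X̂(c)‖ ≤ 404ℓα‖X‖` per bond) and the
NONLINEAR `ψ_{U₀}(X)` ((β-3) ✓`norm_chartRead_sub_fderiv_le_global(_SU2)`: `‖↑(ψ(X)c) − ↑((Dψ(0)X)c)‖ ≤ C·ℓ²‖X‖²` for EVERY `X`).  `--kind proof --supports stmt-QuantumFields-20520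
--as helper`, count-neutral, DEFINITION-FREE; generic `P : Params`, `SU(N)` (the nonlinear edition also specialised to `SU(2)`).

NOTATION (written out).  `X : PBond P j → 𝔰𝔲(N)` (chart coordinates, sup norm `‖X‖`), `X̂ b = ↑(X b)` its matrix field (`‖X̂‖ ≤ ‖X‖`, ✓`norm_coePi_le`); `Ū = avgFun expMeanLogSU`;
coarse plaquette `p′ = (y; μ, ν)` read as `[μ⁺, ν⁺, μ̄, ν̄]`; `Y_V(∂p′)[Z] = covWalkSum V Z (walk y [μ⁺,ν⁺,μ̄,ν̄])`; the (CURL-AVG) right-hand side of FILE B2 at size `m`: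
`CA(m) := |I|⁻¹Σ_iΣ_{s,t<L}‖Y_{U₀}(walk (x_i+(s+1)e_μ+t e_ν) [ν⁺,μ̄,ν̄,μ⁺])[X̂]‖ + L·L·2δ(L+2L+2)·m + 48α·L·m + (2α_p + 24α)·ℓ·m` (written out in each signature).

WHAT IS PROVED (sorry-free).
* §1 `covWalkSum_sub` (linearity), `norm_covWalkSum_plaq_le` (`‖Y_V(∂p′)[Z]‖ ≤ 4·m` if `‖Z c‖ ≤ m`), `curlAvgBound_mono` (the B2 right-hand side is monotone in the size).
* §2 ★★★`norm_curl_fderiv_chartRead_le` — **`‖Y_{Ū(U₀)}(∂p′)[c ↦ ↑((Dψ_{U₀}(0)X)c)]‖ ≤ CA(‖X‖) + 4·(404·ℓ·α·‖X‖)`** (`α ≤ 1∕24`, `α < δ_N`, `PlaqSmall δ U₀`, `dist1 Ū(∂p′) ≤ α_p`).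
* §3 ★★★`norm_curl_chartRead_le` (generic `N`, `0 < ρ ≤ innerRadius`, `4α ≤ ρ`) — **`‖Y_{Ū(U₀)}(∂p′)[c ↦ ↑(ψ_{U₀}(X)c)]‖ ≤ CA(‖X‖) + 4·404ℓα‖X‖ + 4·(448000∕ρ² + 172800∕ρ)·ℓ²·‖X‖²`**;
  ★★★`norm_curl_chartRead_le_SU2` — the same for `SU(2)` with `4·4550400·ℓ²·‖X‖²` (`α ≤ 1∕24`).

WHY.  The (SCT) discharger reads stage fields through `ψ` and `Dψ(0)` (the sup chain's letters (β-3) ✓p828183, (D2-loc) ✓p828965 ∕ Q10 ✓p828851, Q7 ✓p827759); this file puts the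
(CURL-AVG) brick in that currency: first order exact structure (B2) + the (D1) defect + the sup second-order remainder, all with printed-size-free explicit constants.

HONEST.  Triangle inequalities over LANDED letters (B2, (D1) ✓p824693, (β-3) ✓p828183, ✓`norm_coePi_le`); nothing of Bałaban's analysis asserted; (SCT), (ST), LOC ∕ `hLoc`, AVG₂♭-ax_q,
GAP♯∘ (registry 3732b7df UNTOUCHED, 0∕5), the five REGISTERED stubs, S2β, crux 20520, 19936, 19200, `YM3TorusSU2` — NOT proved; rung R3 = SU(2) YM₃ on T³ at fixed lattice data —
NOT d = 4, NOT infinite volume, NOT a mass gap, NOT Clay; the Yang–Mills mass gap is NOT proved.  Axioms standard.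

References: [Balaban1985Averaging] CMP **98** (1985) (19)–(20) p.21, Prop. 1 (51) p.26, (58) p.27, Prop. 3 (121)–(126) p.36; [Balaban1987RG1] CMP **109** (1987) (0.4), (0.8) p.253.
-/

set_option autoImplicit false

noncomputable section

open scoped Matrix.Norms.L2Operator BigOperators
open Finset

namespace Summit.QuantumFields.YangMills.Theorems.FluctuationComparisonRegPrIntLS2BetaCoarseCurlOfChartRead

open Literature.MathematicalPhysics.QuantumFieldTheory.Balaban1983to89
open Literature.MathematicalPhysics.QuantumFieldTheory.Balaban1983to89.T4Continuum
open Literature.MathematicalPhysics.QuantumFieldTheory.Balaban1983to89.HaarExponentialChart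
open Literature.MathematicalPhysics.QuantumFieldTheory.Balaban1983to89.HaarExponentialChart.IsChartRep
open Literature.MathematicalPhysics.QuantumFieldTheory.Balaban1983to89.BlockAveraging (Idx avgFun loopHol off corr Small)
open Literature.MathematicalPhysics.QuantumFieldTheory.Balaban1983to89.ExpMeanLog (expMeanLogSU deltaSU)
open Literature.MathematicalPhysics.QuantumFieldTheory.Balaban1983to89.BlockAveragingEMLLinearised (stepFactor length_walk)
open Literature.MathematicalPhysics.QuantumFieldTheory.Balaban1983to89.BlockAveragingEMLLinearisedBackground
  (covStep covWalkSum covWalkSum_nil covWalkSum_cons covWalkSum_add covLinAvgR0 norm_covWalkSum_le)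
open Literature.MathematicalPhysics.QuantumFieldTheory.Balaban1983to89.Node00
open Summit.QuantumFields.YangMills.Theorems.FluctuationComparisonRegPrIntLS2BetaChartReadCplxAnalytic (norm_coePi_le)
open Summit.QuantumFields.YangMills.Theorems.FluctuationComparisonRegPrIntLS2BetaChartReadDerivCovLinAvg (norm_fderiv_chartRead_sub_covLinAvgR0_le)
open Summit.QuantumFields.YangMills.Theorems.FluctuationComparisonRegPrIntLS2BetaChartReadSecondOrder (norm_chartRead_sub_fderiv_le_global norm_chartRead_sub_fderiv_le_global_SU2)
open Summit.QuantumFields.YangMills.Theorems.FluctuationComparisonRegPrIntLS2BetaCoarseCurlOfLinAvg (norm_curl_covLinAvgR0_le)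

variable {P : Params} {j : ℕ} {N : ℕ} [NeZero N]

/-! ## §1 Linearity of the curl in the field, the four-term bound, monotonicity of the (CURL-AVG) bound in the size -/

section Letters

omit [NeZero N] in
/-- `Y_V(γ)[Z₁] − Y_V(γ)[Z₂] = Y_V(γ)[Z₁ − Z₂]`. [cite: Balaban1985Averaging, (58) p.27 (bookkeeping)] -/
theorem covWalkSum_sub {k : ℕ} (V : GaugeField P k (SU N)) (Z₁ Z₂ : PBond P k → Matrix (Fin N) (Fin N) ℂ) (γ : List (LStep P k)) :
    covWalkSum V Z₁ γ - covWalkSum V Z₂ γ = covWalkSum V (Z₁ - Z₂) γ := by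
  have h := covWalkSum_add V (Z₁ - Z₂) Z₂ γ
  rw [sub_add_cancel] at h
  rw [h, add_sub_cancel_right]

/-- `‖Y_V(∂p′)[Z]‖ ≤ 4·m` when `‖Z c‖ ≤ m` at every coarse bond. [cite: Balaban1985Averaging, (58) p.27 (bookkeeping)] -/
theorem norm_covWalkSum_plaq_le {k : ℕ} (V : GaugeField P k (SU N)) {Z : PBond P k → Matrix (Fin N) (Fin N) ℂ} {m : ℝ} (hZ : ∀ c, ‖Z c‖ ≤ m) (y : Site P k) (μ ν : Fin P.d) :
    ‖covWalkSum V Z (walk y [((μ, true) : Letter P.d), (ν, true), (μ, false), (ν, false)])‖ ≤ 4 * m := by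
  have h := norm_covWalkSum_le V hZ (walk y [((μ, true) : Letter P.d), (ν, true), (μ, false), (ν, false)])
  rw [length_walk] at h
  simpa using h

omit [NeZero N] in
/-- The (CURL-AVG) right-hand side is monotone in the size parameter (its coefficients are nonnegative). [folklore] -/
theorem curlAvgBound_mono {S δ α αp ℓ Lr m m' : ℝ} (hδ : 0 ≤ δ) (hα : 0 ≤ α) (hαp : 0 ≤ αp) (hℓ : 0 ≤ ℓ) (hL : 0 ≤ Lr) (hm : m ≤ m') :
    S + Lr * (Lr * (2 * δ * (Lr + 2 * Lr + 2) * m)) + 48 * α * (Lr * m) + (2 * αp * (ℓ * m) + 24 * α * (ℓ * m)) ≤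
      S + Lr * (Lr * (2 * δ * (Lr + 2 * Lr + 2) * m')) + 48 * α * (Lr * m') + (2 * αp * (ℓ * m') + 24 * α * (ℓ * m')) := by
  have h1 : Lr * (Lr * (2 * δ * (Lr + 2 * Lr + 2) * m)) ≤ Lr * (Lr * (2 * δ * (Lr + 2 * Lr + 2) * m')) := by gcongr
  have h2 : 48 * α * (Lr * m) ≤ 48 * α * (Lr * m') := by gcongr
  have h3 : 2 * αp * (ℓ * m) ≤ 2 * αp * (ℓ * m') := by gcongr
  have h4 : 24 * α * (ℓ * m) ≤ 24 * α * (ℓ * m') := by gcongr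
  linarith

end Letters

/-! ## §2 ★★★ The coarse linearised curl of the TRUE derivative `Dψ_{U₀}(0)X` -/

section Deriv

/-- ★★★ **(CURL-AVG) FOR THE TRUE ONE-STEP DERIVATIVE**: at a background `U₀` in the loop `α`-guard at every coarse bond (`α ≤ 1∕24`, `α < δ_N`) with fine plaquettes within `δ` of `1`, for
the coarse plaquette `p′ = (y; μ, ν)` with `dist1 Ū(U₀)(∂p′) ≤ α_p`, and every direction `X`:
`‖Y_{Ū(U₀)}(∂p′)[c ↦ ↑((Dψ_{U₀}(0)X)c)]‖ ≤ |I|⁻¹Σ_iΣ_{s,t<L}‖Y_{U₀}(∂q_{i,s,t})[X̂]‖ + L·L·2δ(3L+2)·‖X‖ + 48α·L·‖X‖ + (2α_p + 24α)·ℓ·‖X‖ + 4·(404·ℓ·α·‖X‖)`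
(B2 ✓`norm_curl_covLinAvgR0_le` at `Y = X̂` + the (D1) defect on the four bonds of `∂p′`). [cite: Balaban1985Averaging, Prop. 1 (51) p.26, Prop. 3 (121)-(126) p.36; Balaban1987RG1, (0.4) p.253] -/
theorem norm_curl_fderiv_chartRead_le (U₀ : GaugeField P j (SU N)) {α : ℝ} (hα : ∀ (c : PBond P (j + 1)) (i : Idx P), dist1 (loopHol U₀ c i) ≤ α)
    (hα24 : α ≤ 1 / 24) (hαδ : α < deltaSU (Fin N)) {δ : ℝ} (hδ : 0 ≤ δ) (hU : PlaqSmall δ U₀) (y : Site P (j + 1)) (μ ν : Fin P.d) {αp : ℝ}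
    (hαp : dist1 (holAt (avgFun (expMeanLogSU (n := Fin N)) U₀) (walk y [((μ, true) : Letter P.d), (ν, true), (μ, false), (ν, false)])) ≤ αp)
    (X : PBond P j → (specialUnitaryLogChart (Fin N)).lie) :
    ‖covWalkSum (avgFun (expMeanLogSU (n := Fin N)) U₀)
        (fun c : PBond P (j + 1) => ((fderiv ℝ (fun (A : PBond P j → (specialUnitaryLogChart (Fin N)).lie) (c : PBond P (j + 1)) =>
          (isChartRep_specialUnitaryGroup (n := Fin N)).logChart
            (avgFun (expMeanLogSU (n := Fin N)) (fun b => (isChartRep_specialUnitaryGroup (n := Fin N)).expChart (A b) * U₀ b) c *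
              (avgFun (expMeanLogSU (n := Fin N)) U₀ c)⁻¹)) 0 X c : (specialUnitaryLogChart (Fin N)).lie) : Matrix (Fin N) (Fin N) ℂ))
        (walk y [((μ, true) : Letter P.d), (ν, true), (μ, false), (ν, false)])‖ ≤
      (Fintype.card (Idx P) : ℝ)⁻¹ * ∑ i : Idx P, ∑ s ∈ Finset.range P.L, ∑ t ∈ Finset.range P.L,
          ‖covWalkSum U₀ (fun b => ((X b : (specialUnitaryLogChart (Fin N)).lie) : Matrix (Fin N) (Fin N) ℂ))
            (walk (walkEnd (walkEnd (emb y) (stairWord i.2.1 (off i.1))) (List.replicate (s + 1) (μ, true) ++ List.replicate t (ν, true)))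
            [((ν, true) : Letter P.d), (μ, false), (ν, false), (μ, true)])‖ +
        (P.L : ℝ) * ((P.L : ℝ) * (2 * δ * ((P.L : ℝ) + 2 * P.L + 2) * ‖X‖)) + 48 * α * ((P.L : ℝ) * ‖X‖) +
        (2 * αp * ((((P.d + 2) * P.L : ℕ) : ℝ) * ‖X‖) + 24 * α * ((((P.d + 2) * P.L : ℕ) : ℝ) * ‖X‖)) +
        4 * (404 * (((P.d + 2) * P.L : ℕ) : ℝ) * α * ‖X‖) := by
  set V := avgFun (expMeanLogSU (n := Fin N)) U₀ with hV
  set w : List (Letter P.d) := [((μ, true) : Letter P.d), (ν, true), (μ, false), (ν, false)] with hw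
  set Xm : PBond P j → Matrix (Fin N) (Fin N) ℂ := fun b => ((X b : (specialUnitaryLogChart (Fin N)).lie) : Matrix (Fin N) (Fin N) ℂ) with hXm
  set D : PBond P (j + 1) → Matrix (Fin N) (Fin N) ℂ := fun c : PBond P (j + 1) => ((fderiv ℝ (fun (A : PBond P j → (specialUnitaryLogChart (Fin N)).lie) (c : PBond P (j + 1)) =>
          (isChartRep_specialUnitaryGroup (n := Fin N)).logChart
            (avgFun (expMeanLogSU (n := Fin N)) (fun b => (isChartRep_specialUnitaryGroup (n := Fin N)).expChart (A b) * U₀ b) c *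
              (avgFun (expMeanLogSU (n := Fin N)) U₀ c)⁻¹)) 0 X c : (specialUnitaryLogChart (Fin N)).lie) : Matrix (Fin N) (Fin N) ℂ) with hD
  have hα0 : 0 ≤ α := (GaugeGroup.dist1_nonneg _).trans (hα ⟨y, μ⟩ (Classical.arbitrary _))
  have hαp0 : 0 ≤ αp := (GaugeGroup.dist1_nonneg _).trans hαp
  -- first order: (CURL-AVG) for `Q₁^{R₀}(U₀)X̂`, with `‖X̂‖ ≤ ‖X‖`
  have hQ := norm_curl_covLinAvgR0_le U₀ Xm hα hαδ (by linarith) hδ hU y μ ν hαp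
  have hXm : ‖Xm‖ ≤ ‖X‖ := norm_coePi_le X
  have hQ' := hQ.trans (curlAvgBound_mono hδ hα0 hαp0 (Nat.cast_nonneg _) (Nat.cast_nonneg _) hXm)
  -- the (D1) defect at the four bonds
  have hdef : ∀ c : PBond P (j + 1), ‖(D - covLinAvgR0 U₀ Xm) c‖ ≤ 404 * (((P.d + 2) * P.L : ℕ) : ℝ) * α * ‖X‖ := fun c =>
    norm_fderiv_chartRead_sub_covLinAvgR0_le U₀ hα hα24 hαδ X c
  have hcurl_def := norm_covWalkSum_plaq_le V hdef y μ ν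
  have e : covWalkSum V D (walk y w) = covWalkSum V (covLinAvgR0 U₀ Xm) (walk y w) + covWalkSum V (D - covLinAvgR0 U₀ Xm) (walk y w) := by
    rw [← covWalkSum_sub]; abel
  rw [e]
  exact (norm_add_le _ _).trans (add_le_add hQ' hcurl_def)

end Deriv

/-! ## §3 ★★★ The coarse linearised curl of the chart-read average `ψ_{U₀}(X)` itself (sup second-order remainder) -/

section Nonlinear

/-- ★★★ **(CURL-AVG) FOR THE NONLINEAR ONE-STEP AVERAGE, generic `N`**: with `0 < ρ ≤ innerRadius`, `4α ≤ ρ` in addition: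
`‖Y_{Ū(U₀)}(∂p′)[c ↦ ↑(ψ_{U₀}(X)c)]‖ ≤ [§2's bound] + 4·((448000∕ρ² + 172800∕ρ)·ℓ²·‖X‖²)` for EVERY `X`. [cite: Balaban1985Averaging, Prop. 1 (51) p.26, Prop. 3 (121)-(126) p.36; Balaban1987RG1, (0.4), (0.8) p.253] -/
theorem norm_curl_chartRead_le (U₀ : GaugeField P j (SU N)) {α ρ : ℝ} (hρ0 : 0 < ρ) (hρ : ρ ≤ innerRadius (specialUnitaryLogChart (Fin N)))
    (hα : ∀ (c : PBond P (j + 1)) (i : Idx P), dist1 (loopHol U₀ c i) ≤ α) (hα4 : 4 * α ≤ ρ) (hα24 : α ≤ 1 / 24) (hαδ : α < deltaSU (Fin N)) {δ : ℝ} (hδ : 0 ≤ δ)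
    (hU : PlaqSmall δ U₀) (y : Site P (j + 1)) (μ ν : Fin P.d) {αp : ℝ}
    (hαp : dist1 (holAt (avgFun (expMeanLogSU (n := Fin N)) U₀) (walk y [((μ, true) : Letter P.d), (ν, true), (μ, false), (ν, false)])) ≤ αp)
    (X : PBond P j → (specialUnitaryLogChart (Fin N)).lie) :
    ‖covWalkSum (avgFun (expMeanLogSU (n := Fin N)) U₀)
        (fun c : PBond P (j + 1) => (((isChartRep_specialUnitaryGroup (n := Fin N)).logChart
            (avgFun (expMeanLogSU (n := Fin N)) (fun b => (isChartRep_specialUnitaryGroup (n := Fin N)).expChart (X b) * U₀ b) c *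
              (avgFun (expMeanLogSU (n := Fin N)) U₀ c)⁻¹) : (specialUnitaryLogChart (Fin N)).lie) : Matrix (Fin N) (Fin N) ℂ))
        (walk y [((μ, true) : Letter P.d), (ν, true), (μ, false), (ν, false)])‖ ≤
      (Fintype.card (Idx P) : ℝ)⁻¹ * ∑ i : Idx P, ∑ s ∈ Finset.range P.L, ∑ t ∈ Finset.range P.L,
          ‖covWalkSum U₀ (fun b => ((X b : (specialUnitaryLogChart (Fin N)).lie) : Matrix (Fin N) (Fin N) ℂ))
            (walk (walkEnd (walkEnd (emb y) (stairWord i.2.1 (off i.1))) (List.replicate (s + 1) (μ, true) ++ List.replicate t (ν, true)))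
            [((ν, true) : Letter P.d), (μ, false), (ν, false), (μ, true)])‖ +
        (P.L : ℝ) * ((P.L : ℝ) * (2 * δ * ((P.L : ℝ) + 2 * P.L + 2) * ‖X‖)) + 48 * α * ((P.L : ℝ) * ‖X‖) +
        (2 * αp * ((((P.d + 2) * P.L : ℕ) : ℝ) * ‖X‖) + 24 * α * ((((P.d + 2) * P.L : ℕ) : ℝ) * ‖X‖)) +
        4 * (404 * (((P.d + 2) * P.L : ℕ) : ℝ) * α * ‖X‖) + 4 * ((448000 / ρ ^ 2 + 172800 / ρ) * (((P.d + 2) * P.L : ℕ) : ℝ) ^ 2 * ‖X‖ ^ 2) := by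
  set V := avgFun (expMeanLogSU (n := Fin N)) U₀ with hV
  set w : List (Letter P.d) := [((μ, true) : Letter P.d), (ν, true), (μ, false), (ν, false)] with hw
  set D : PBond P (j + 1) → Matrix (Fin N) (Fin N) ℂ := fun c : PBond P (j + 1) => ((fderiv ℝ (fun (A : PBond P j → (specialUnitaryLogChart (Fin N)).lie) (c : PBond P (j + 1)) =>
          (isChartRep_specialUnitaryGroup (n := Fin N)).logChart
            (avgFun (expMeanLogSU (n := Fin N)) (fun b => (isChartRep_specialUnitaryGroup (n := Fin N)).expChart (A b) * U₀ b) c *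
              (avgFun (expMeanLogSU (n := Fin N)) U₀ c)⁻¹)) 0 X c : (specialUnitaryLogChart (Fin N)).lie) : Matrix (Fin N) (Fin N) ℂ) with hD
  set Ψ : PBond P (j + 1) → Matrix (Fin N) (Fin N) ℂ := fun c : PBond P (j + 1) => (((isChartRep_specialUnitaryGroup (n := Fin N)).logChart
            (avgFun (expMeanLogSU (n := Fin N)) (fun b => (isChartRep_specialUnitaryGroup (n := Fin N)).expChart (X b) * U₀ b) c *
              (avgFun (expMeanLogSU (n := Fin N)) U₀ c)⁻¹) : (specialUnitaryLogChart (Fin N)).lie) : Matrix (Fin N) (Fin N) ℂ) with hΨ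
  have hD' := norm_curl_fderiv_chartRead_le U₀ hα hα24 hαδ hδ hU y μ ν hαp X
  have hrem : ∀ c : PBond P (j + 1), ‖(Ψ - D) c‖ ≤ (448000 / ρ ^ 2 + 172800 / ρ) * (((P.d + 2) * P.L : ℕ) : ℝ) ^ 2 * ‖X‖ ^ 2 := fun c =>
    norm_chartRead_sub_fderiv_le_global U₀ hρ0 hρ hα hα4 X c
  have hcurl_rem := norm_covWalkSum_plaq_le V hrem y μ ν
  have e : covWalkSum V Ψ (walk y w) = covWalkSum V D (walk y w) + covWalkSum V (Ψ - D) (walk y w) := by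
    rw [← covWalkSum_sub]; abel
  rw [e]
  exact (norm_add_le _ _).trans (add_le_add hD' hcurl_rem)

/-- ★★★ **(CURL-AVG) FOR THE NONLINEAR ONE-STEP AVERAGE, `SU(2)`** (`α ≤ 1∕24`, no radius bookkeeping: `innerRadius ≥ 1∕3`):
`‖Y_{Ū(U₀)}(∂p′)[c ↦ ↑(ψ_{U₀}(X)c)]‖ ≤ [§2's bound] + 4·(4550400·ℓ²·‖X‖²)` for EVERY `X`. [cite: Balaban1985Averaging, Prop. 1 (51) p.26, Prop. 3 (121)-(126) p.36; Balaban1987RG1, (0.4), (0.8) p.253] -/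
theorem norm_curl_chartRead_le_SU2 (U₀ : GaugeField P j (SU 2)) {α : ℝ} (hα : ∀ (c : PBond P (j + 1)) (i : Idx P), dist1 (loopHol U₀ c i) ≤ α) (hα24 : α ≤ 1 / 24)
    (hαδ : α < deltaSU (Fin 2)) {δ : ℝ} (hδ : 0 ≤ δ) (hU : PlaqSmall δ U₀) (y : Site P (j + 1)) (μ ν : Fin P.d) {αp : ℝ}
    (hαp : dist1 (holAt (avgFun (expMeanLogSU (n := Fin 2)) U₀) (walk y [((μ, true) : Letter P.d), (ν, true), (μ, false), (ν, false)])) ≤ αp)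
    (X : PBond P j → (specialUnitaryLogChart (Fin 2)).lie) :
    ‖covWalkSum (avgFun (expMeanLogSU (n := Fin 2)) U₀)
        (fun c : PBond P (j + 1) => (((isChartRep_specialUnitaryGroup (n := Fin 2)).logChart
            (avgFun (expMeanLogSU (n := Fin 2)) (fun b => (isChartRep_specialUnitaryGroup (n := Fin 2)).expChart (X b) * U₀ b) c *
              (avgFun (expMeanLogSU (n := Fin 2)) U₀ c)⁻¹) : (specialUnitaryLogChart (Fin 2)).lie) : Matrix (Fin 2) (Fin 2) ℂ))
        (walk y [((μ, true) : Letter P.d), (ν, true), (μ, false), (ν, false)])‖ ≤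
      (Fintype.card (Idx P) : ℝ)⁻¹ * ∑ i : Idx P, ∑ s ∈ Finset.range P.L, ∑ t ∈ Finset.range P.L,
          ‖covWalkSum U₀ (fun b => ((X b : (specialUnitaryLogChart (Fin 2)).lie) : Matrix (Fin 2) (Fin 2) ℂ))
            (walk (walkEnd (walkEnd (emb y) (stairWord i.2.1 (off i.1))) (List.replicate (s + 1) (μ, true) ++ List.replicate t (ν, true)))
            [((ν, true) : Letter P.d), (μ, false), (ν, false), (μ, true)])‖ +
        (P.L : ℝ) * ((P.L : ℝ) * (2 * δ * ((P.L : ℝ) + 2 * P.L + 2) * ‖X‖)) + 48 * α * ((P.L : ℝ) * ‖X‖) +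
        (2 * αp * ((((P.d + 2) * P.L : ℕ) : ℝ) * ‖X‖) + 24 * α * ((((P.d + 2) * P.L : ℕ) : ℝ) * ‖X‖)) +
        4 * (404 * (((P.d + 2) * P.L : ℕ) : ℝ) * α * ‖X‖) + 4 * (4550400 * (((P.d + 2) * P.L : ℕ) : ℝ) ^ 2 * ‖X‖ ^ 2) := by
  set V := avgFun (expMeanLogSU (n := Fin 2)) U₀ with hV
  set w : List (Letter P.d) := [((μ, true) : Letter P.d), (ν, true), (μ, false), (ν, false)] with hw
  set D : PBond P (j + 1) → Matrix (Fin 2) (Fin 2) ℂ := fun c : PBond P (j + 1) => ((fderiv ℝ (fun (A : PBond P j → (specialUnitaryLogChart (Fin 2)).lie) (c : PBond P (j + 1)) =>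
          (isChartRep_specialUnitaryGroup (n := Fin 2)).logChart
            (avgFun (expMeanLogSU (n := Fin 2)) (fun b => (isChartRep_specialUnitaryGroup (n := Fin 2)).expChart (A b) * U₀ b) c *
              (avgFun (expMeanLogSU (n := Fin 2)) U₀ c)⁻¹)) 0 X c : (specialUnitaryLogChart (Fin 2)).lie) : Matrix (Fin 2) (Fin 2) ℂ) with hD
  set Ψ : PBond P (j + 1) → Matrix (Fin 2) (Fin 2) ℂ := fun c : PBond P (j + 1) => (((isChartRep_specialUnitaryGroup (n := Fin 2)).logChart
            (avgFun (expMeanLogSU (n := Fin 2)) (fun b => (isChartRep_specialUnitaryGroup (n := Fin 2)).expChart (X b) * U₀ b) c *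
              (avgFun (expMeanLogSU (n := Fin 2)) U₀ c)⁻¹) : (specialUnitaryLogChart (Fin 2)).lie) : Matrix (Fin 2) (Fin 2) ℂ) with hΨ
  have hD' := norm_curl_fderiv_chartRead_le U₀ hα hα24 hαδ hδ hU y μ ν hαp X
  have hrem : ∀ c : PBond P (j + 1), ‖(Ψ - D) c‖ ≤ 4550400 * (((P.d + 2) * P.L : ℕ) : ℝ) ^ 2 * ‖X‖ ^ 2 := fun c =>
    norm_chartRead_sub_fderiv_le_global_SU2 U₀ hα (by linarith) X c
  have hcurl_rem := norm_covWalkSum_plaq_le V hrem y μ ν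
  have e : covWalkSum V Ψ (walk y w) = covWalkSum V D (walk y w) + covWalkSum V (Ψ - D) (walk y w) := by
    rw [← covWalkSum_sub]; abel
  rw [e]
  exact (norm_add_le _ _).trans (add_le_add hD' hcurl_rem)

end Nonlinear

end Summit.QuantumFields.YangMills.Theorems.FluctuationComparisonRegPrIntLS2BetaCoarseCurlOfChartRead

end
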